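import Mathlib
import Literature.Analysis.FluidPDE.SelfSimilar
import HarnessLib

/-!
# Extraction of convergent DSS factors and rotations from a window sequence

Analysis/FluidPDE support file (everything proved; no definitions, no named facts).

In a Type-I rotated-DSS extraction argument (Koch–Nadirashvili–Seregin–Šverák 2009, §6;
Chae–Wolf 2017; Bradshaw–Tsai 2017, §5.1) the approximants `uₙ` are rotated-DSS with factors
`cₙ` confined to a WINDOW `[c_min, c_max]` and rotations `Rₙ ∈ O(E)`; before the compactness of
the fields is invoked one passes to a subsequence along which `cₙ → c' ∈ [c_min, c_max]` and
`Rₙ → R'` for some rotation `R'` — Bolzano–Weierstrass on the window and the COMPACTNESS OF THE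
GROUP OF LINEAR ISOMETRIES of the finite-dimensional space `E` (a closed subset of the unit ball of
`L(E, E)`, which is compact because `L(E, E)` is finite-dimensional). This file proves exactly that
bookkeeping, in the pointwise form in which the tree states rotation convergence
(`∀ x, Rₙ x → R' x`, as in the ladder-limit packages of
`Summits/NavierStokesRegularity/FluidComputer/AngularGalerkinLadder.lean`'s route and in
`RotatedDSSLimitStructure.lean`):

* `isCompact_setOf_linearIsometry` — `{T ∈ L(E, E) | ∀ x, ‖T x‖ = ‖x‖}` is compact (same argument as
  the tree's `Literature.Geometry.Riemannian.isCompact_setOf_norm_map_eq`, restated for `E → E` to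
  keep this file's import cone inside Mathlib + `SelfSimilar`);
* `exists_subseq_tendsto_linearIsometryEquiv` — every sequence of linear isometric automorphisms
  `Rₙ : E ≃ₗᵢ[ℝ] E` has a subsequence converging pointwise (indeed in operator norm) to some
  `R' : E ≃ₗᵢ[ℝ] E` (a norm-preserving linear limit is injective, hence — `E` being
  finite-dimensional — an isometric automorphism, `LinearIsometry.toLinearIsometryEquiv`);
* `exists_subseq_window_tendsto` — jointly with factors in a window: for `cₙ ∈ [a, b]` and
  rotations `Rₙ` there are `φ` strictly monotone, `c' ∈ [a, b]` and `R'` with `c_{φ n} → c'` and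
  `R_{φ n} x → R' x` for every `x`.

WHAT THIS IS NOT: nothing about the fields `uₙ` — their compactness is the analytic content of an
extraction (KNSS 2009, Lemma 6.1: tree `exists_oseenMild_limit_of_monotone_bound`); here only the
finite-dimensional parameters are extracted.

## References

* G. Koch, N. Nadirashvili, G. Seregin, V. Šverák, *Liouville theorems for the Navier–Stokes
  equations and applications*, Acta Math. 203 (2009) = arXiv:0709.3599, §6 (rescaling and passage
  to a subsequence in the proof of Thm 6.2, p. 13). [KochNadirashviliSereginSverak2009]
* D. Chae, J. Wolf, *Removing discretely self-similar singularities for the 3D Navier–Stokes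
  equations*, Comm. PDE 42 (2017) = arXiv:1610.09464, Def. 1.1 (rotated DSS: factor `λ > 1` and
  `R ∈ O(3)`). [ChaeWolf2017]
* Z. Bradshaw, T.-P. Tsai, *Forward discretely self-similar solutions of the Navier–Stokes equations
  II*, Ann. Henri Poincaré 18 (2017) = arXiv:1510.07504, §5.1 (limits along varying DSS factors).
  [BradshawTsai2017AHP]
-/

noncomputable section

open Set Function Filter Metric
open _root_.Topology

namespace Literature.Analysis.FluidPDE

variable {E : Type*} [NormedAddCommGroup E] [NormedSpace ℝ E] [FiniteDimensional ℝ E]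

/-- **The linear isometries `E → E` of a finite-dimensional real normed space form a compact subset
of `L(E, E)`**: closed (pointwise norm conditions) and inside the closed unit ball, which is compact
since `L(E, E)` is finite-dimensional. (Same argument as the tree's
`Literature.Geometry.Riemannian.isCompact_setOf_norm_map_eq`; the compactness of `O(E)` used when a
rotated-DSS sequence is passed to a subsequence, Chae–Wolf 2017, Def. 1.1.)
[cite: ChaeWolf2017, Def. 1.1] -/
theorem isCompact_setOf_linearIsometry :
    IsCompact {T : E →L[ℝ] E | ∀ x, ‖T x‖ = ‖x‖} := by
  haveI : ProperSpace (E →L[ℝ] E) := FiniteDimensional.proper_real _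
  refine Metric.isCompact_of_isClosed_isBounded ?_ ?_
  · have h : {T : E →L[ℝ] E | ∀ x, ‖T x‖ = ‖x‖} = ⋂ x, {T : E →L[ℝ] E | ‖T x‖ = ‖x‖} := by
      ext T
      simp
    rw [h]
    exact isClosed_iInter fun x =>
      isClosed_eq (ContinuousLinearMap.apply ℝ E x).continuous.norm continuous_const
  · refine (Metric.isBounded_closedBall (x := (0 : E →L[ℝ] E)) (r := 1)).subset fun T hT => ?_
    rw [mem_closedBall_zero_iff]
    exact ContinuousLinearMap.opNorm_le_bound _ zero_le_one fun x => by
      rw [one_mul, (show ‖T x‖ = ‖x‖ from hT x)]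

/-- **Sequential compactness of the isometric automorphisms, pointwise form.** Every sequence
`Rₙ : E ≃ₗᵢ[ℝ] E` of linear isometric automorphisms of a finite-dimensional real normed space has a
subsequence `R_{φ n}` converging in operator norm, hence pointwise (`R_{φ n} x → R' x` for every `x`),
to a linear isometric automorphism `R'` (the operator-norm limit preserves norms, so it is an
injective linear isometry of the finite-dimensional space `E`, hence surjective:
`LinearIsometry.toLinearIsometryEquiv`). The «`Rₙ → R'`» step of every rotated-DSS extraction.
[cite: ChaeWolf2017, Def. 1.1] -/
theorem exists_subseq_tendsto_linearIsometryEquiv (R : ℕ → E ≃ₗᵢ[ℝ] E) :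
    ∃ (φ : ℕ → ℕ) (R' : E ≃ₗᵢ[ℝ] E), StrictMono φ ∧
      Tendsto (fun n => (R (φ n)).toLinearIsometry.toContinuousLinearMap) atTop
        (𝓝 R'.toLinearIsometry.toContinuousLinearMap) ∧
      ∀ x, Tendsto (fun n => R (φ n) x) atTop (𝓝 (R' x)) := by
  obtain ⟨T, hT, φ, hφ, hconv⟩ := (isCompact_setOf_linearIsometry (E := E)).tendsto_subseq
    (x := fun n => (R n).toLinearIsometry.toContinuousLinearMap) fun n x => (R n).norm_map x
  -- the limit is a linear isometry, hence (finite dimension) an isometric automorphism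
  set L₀ : E →ₗᵢ[ℝ] E := ⟨(T : E →ₗ[ℝ] E), hT⟩ with hL₀
  have hTe : L₀.toContinuousLinearMap = T := by
    ext
    rfl
  set R' : E ≃ₗᵢ[ℝ] E := L₀.toLinearIsometryEquiv rfl with hR'
  have hR'e : R'.toLinearIsometry.toContinuousLinearMap = T := by
    ext x
    simp [hR', hL₀]
  refine ⟨φ, R', hφ, by rw [hR'e]; exact hconv, fun x => ?_⟩
  have h1 : Tendsto (fun n => (R (φ n)).toLinearIsometry.toContinuousLinearMap x) atTop
      (𝓝 (T x)) := by
    have h2 := ((ContinuousLinearMap.apply ℝ E x).continuous.tendsto T).comp hconv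
    simpa only [Function.comp_def, ContinuousLinearMap.apply_apply] using h2
  have h3 : R' x = T x := by simp [hR', hL₀]
  rw [h3]
  simpa using h1

/-- **Extraction of a window sequence's parameters**: factors `cₙ ∈ [a, b]` and isometric
automorphisms `Rₙ` of a finite-dimensional real normed space admit a common subsequence along which
`c_{φ n} → c' ∈ [a, b]` and `R_{φ n} x → R' x` for every `x` (Bolzano–Weierstrass on the window, then
`exists_subseq_tendsto_linearIsometryEquiv` along the first subsequence). This is the «after
extraction» clause of the limit-transfer step of a Type-I rotated-DSS profile extraction with factors
in a fixed window (Bradshaw–Tsai: limits along varying factors `λ_k`; Chae–Wolf: `R ∈ O(3)`).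
[cite: BradshawTsai2017AHP, §5.1, proof of Thm 1.3] -/
theorem exists_subseq_window_tendsto {c : ℕ → ℝ} {a b : ℝ} (hc : ∀ n, c n ∈ Icc a b)
    (R : ℕ → E ≃ₗᵢ[ℝ] E) :
    ∃ (φ : ℕ → ℕ) (c' : ℝ) (R' : E ≃ₗᵢ[ℝ] E), StrictMono φ ∧ c' ∈ Icc a b ∧
      Tendsto (fun n => c (φ n)) atTop (𝓝 c') ∧
      ∀ x, Tendsto (fun n => R (φ n) x) atTop (𝓝 (R' x)) := by
  -- factors first
  obtain ⟨c', hc', φ₁, hφ₁, hc1⟩ := tendsto_subseq_of_bounded (isBounded_Icc a b) hc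
  rw [isClosed_Icc.closure_eq] at hc'
  -- then the rotations along `φ₁`
  obtain ⟨φ₂, R', hφ₂, -, hR⟩ := exists_subseq_tendsto_linearIsometryEquiv (fun n => R (φ₁ n))
  refine ⟨φ₁ ∘ φ₂, c', R', hφ₁.comp hφ₂, hc', ?_, fun x => ?_⟩
  · exact hc1.comp hφ₂.tendsto_atTop
  · simpa only [Function.comp] using hR x

/-- The same extraction, carrying along ANY auxiliary sequence already known to converge (e.g. the
defect sizes `εₙ → 0` of a window sequence, which stay convergent along the subsequence).
[cite: BradshawTsai2017AHP, §5.1, proof of Thm 1.3] -/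
theorem exists_subseq_window_tendsto' {c : ℕ → ℝ} {a b : ℝ} (hc : ∀ n, c n ∈ Icc a b)
    (R : ℕ → E ≃ₗᵢ[ℝ] E) {ε : ℕ → ℝ} {ε' : ℝ} (hε : Tendsto ε atTop (𝓝 ε')) :
    ∃ (φ : ℕ → ℕ) (c' : ℝ) (R' : E ≃ₗᵢ[ℝ] E), StrictMono φ ∧ c' ∈ Icc a b ∧
      Tendsto (fun n => c (φ n)) atTop (𝓝 c') ∧
      (∀ x, Tendsto (fun n => R (φ n) x) atTop (𝓝 (R' x))) ∧
      Tendsto (fun n => ε (φ n)) atTop (𝓝 ε') := by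
  obtain ⟨φ, c', R', hφ, hc', hcl, hR⟩ := exists_subseq_window_tendsto hc R
  exact ⟨φ, c', R', hφ, hc', hcl, hR, hε.comp hφ.tendsto_atTop⟩

end Literature.Analysis.FluidPDE

end
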